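import Summits.BirchSwinnertonDyer.BirchSwinnertonDyer.Theorems.ManinLocalTwoThreeTwoShiftLaws
import HarnessLib

/-!
# The 2-ADIC TWIN, II: the descent engine `Γ₀(4m) → Γ₀(2m)` — an additive `ε`-eigenfunction of the 2-shift on `Γ₀(4m)`
# descends as soon as `φ(P₁) = φ(P_{1/2})`
# (route `ManinLocalTwoThree`, cell bsd-f2-manin; crux C2 `ManinOddAtFour` stmt-BirchSwinnertonDyer-22967; prover seat p3 gen 11)

Port to `p = 2` of the seat's `p = 3` engine `ThreeShiftDescent.descent` (`…ThreeShiftDescentEngine.lean`, MEMO-es §37.8): let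
`φ : Γ₀(4m) → K` (any commutative ring `K`, any `ε : K`) be additive with `φ(a, 2b; c, d) = ε·φ(a, b; 2c, d)` whenever `4m ∣ c`,
and suppose `φ(P₁) = φ(P_{1/2})` for the two parabolics `P_{1/2} = (1−2m, m; −4m, 1+2m)` (cusp `1/2`) and `P₁ = (1−4m, 4m; −4m, 1+4m)`
(cusp `1`) of `Γ₀(4m)`; then `φ` is the restriction of an additive `ε`-eigenfunction `w : Γ₀(2m) → K` (**`TwoShift.descent`**).
Mechanism, verbatim from `p = 3` with `3 ↦ 2`: in `G = Γ₀(2m)` take `A = {2 ∣ b} = diag(2,1)Γ₀(4m)diag(2,1)⁻¹` (normal: `a ≡ d`,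
`c ≡ 0 (mod 2)`) and `B = Γ₀(4m)`; `α := ε·φ∘coshift` is additive on `A`, `φ` on `B`, they agree on `A ∩ B` by the eigen-relation,
`G = A·⟨T⟩` with `n(g) = ab` (`2 ∣ 1 − a²`), `Q₁ = (1−2m, 2m; −2m, 1+2m)` generates `A` modulo `A ∩ B ≅` index `2` (DICHOTOMY), and the
single instance `α(TQ₁T⁻¹) = α(Q₁)` of conjugation invariance is literally `φ(P₁) = φ(P_{1/2})`; the tree's abstract
`conj_invariant_of_generator` + `glue` (seat p3 g10, `…ThreeShiftGlue.lean`) do the rest.  What a caller must still supply is the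
vanishing `φ(P₁) = φ(P_{1/2})` — automatic for `16 ∣ 4m`, absorbed by `χ₄`/`χ₈` resp. refuted for `ε ≠ 1` at the two low depths
(sibling `…TwoShiftTower.lean`).  Nothing about BSD, Manin's conjecture or C2 is asserted here.
Reference: cell memo HOME/MEMO-es.md §37.8 [cite: DarmonDiamondTaylor1995, Lemma 4.28 (p. 135)].
-/

set_option autoImplicit false
set_option linter.dupNamespace false

open scoped MatrixGroups

open CongruenceSubgroup Matrix.SpecialLinearGroup
open Summit.BirchSwinnertonDyer.Rank1Residual.ManinAdditive.NineShiftEqualiser (slOf g0Of slOf_apply_00 slOf_apply_01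
  slOf_apply_10 slOf_apply_11 slOf_mem_gamma0 g0Of_congr)
open Summit.BirchSwinnertonDyer.BirchSwinnertonDyer.Theorems.ManinLocalTwoThree.ThreeShiftDescent (g0Of_mul det_mul_entries
  Tpow Tpow_mul_Tpow Tpow_zero Tpow_inv g0Of_mul_Tpow Tpow_one_mul_mul_Tpow_neg_one conj_invariant_of_generator glue)

namespace Summit.BirchSwinnertonDyer.BirchSwinnertonDyer.Theorems.ManinLocalTwoThree

namespace TwoShift

/-! ### §1. The concrete pair `A = {2 ∣ b} ⊇ C ⊆ B = Γ₀(4m)` inside `Γ₀(2m)` -/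

section Concrete

variable (m : ℕ)

/-- `A = {γ ∈ Γ₀(2m) : 2 ∣ b_γ}` = `diag(2,1) Γ₀(4m) diag(2,1)⁻¹`, as a subgroup of `Γ₀(2m)`. [folklore] -/
def subA : Subgroup (Gamma0 (2 * m)) where
  carrier := {γ | (2 : ℤ) ∣ ((γ : SL(2, ℤ)) 0 1 : ℤ)}
  mul_mem' := by
    intro x y hx hy
    simp only [Set.mem_setOf_eq] at hx hy ⊢
    have e : (((x * y : Gamma0 (2 * m)) : SL(2, ℤ)) 0 1 : ℤ) =
        (x : SL(2, ℤ)) 0 0 * (y : SL(2, ℤ)) 0 1 + (x : SL(2, ℤ)) 0 1 * (y : SL(2, ℤ)) 1 1 := by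
      simp [Matrix.mul_apply, Fin.sum_univ_two]
    rw [e]
    exact dvd_add (Dvd.dvd.mul_left hy _) (Dvd.dvd.mul_right hx _)
  one_mem' := by simp
  inv_mem' := by
    intro x hx
    simp only [Set.mem_setOf_eq] at hx ⊢
    have e : (((x⁻¹ : Gamma0 (2 * m)) : SL(2, ℤ)) 0 1 : ℤ) = -((x : SL(2, ℤ)) 0 1) := by
      simp [Matrix.SpecialLinearGroup.coe_inv, Matrix.adjugate_fin_two]
    rw [e]
    exact hx.neg_right

/-- Membership in `subA`. [folklore] -/
theorem mem_subA {γ : Gamma0 (2 * m)} : γ ∈ subA m ↔ (2 : ℤ) ∣ ((γ : SL(2, ℤ)) 0 1 : ℤ) := Iff.rfl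

/-- `A` is normal in `Γ₀(2m)` (`2 ∣ d − a`, `2 ∣ c`). [folklore] -/
theorem subA_normal : (subA m).Normal := by
  refine ⟨fun x hx g => ?_⟩
  rw [mem_subA] at hx ⊢
  obtain ⟨hda, -, -⟩ := two_dvd_of_det (M := 2 * m) ⟨m, rfl⟩ (gamma0_det_entries x)
    ((ZMod.intCast_zmod_eq_zero_iff_dvd _ _).mp (Gamma0_mem.mp x.2))
  have hc : (2 : ℤ) ∣ (x : SL(2, ℤ)) 1 0 := (show (2 : ℤ) ∣ ((2 * m : ℕ) : ℤ) from ⟨m, by push_cast; ring⟩).trans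
    ((ZMod.intCast_zmod_eq_zero_iff_dvd _ _).mp (Gamma0_mem.mp x.2))
  have e : (((g * x * g⁻¹ : Gamma0 (2 * m)) : SL(2, ℤ)) 0 1 : ℤ) =
      (g : SL(2, ℤ)) 0 0 * (g : SL(2, ℤ)) 0 1 * ((x : SL(2, ℤ)) 1 1 - (x : SL(2, ℤ)) 0 0) +
        (g : SL(2, ℤ)) 0 0 * (g : SL(2, ℤ)) 0 0 * (x : SL(2, ℤ)) 0 1 -
        (g : SL(2, ℤ)) 0 1 * (g : SL(2, ℤ)) 0 1 * (x : SL(2, ℤ)) 1 0 := by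
    simp [Matrix.mul_apply, Fin.sum_univ_two, Matrix.SpecialLinearGroup.coe_inv, Matrix.adjugate_fin_two]
    ring
  rw [e]
  exact dvd_sub (dvd_add (Dvd.dvd.mul_left hda _) (Dvd.dvd.mul_left hx _)) (Dvd.dvd.mul_left hc _)

/-- `B = Γ₀(4m)` as a subgroup of `Γ₀(2m)`. [folklore] -/
def subB : Subgroup (Gamma0 (2 * m)) where
  carrier := {γ | ((2 * (2 * m) : ℕ) : ℤ) ∣ ((γ : SL(2, ℤ)) 1 0 : ℤ)}
  mul_mem' := by
    intro x y hx hy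
    simp only [Set.mem_setOf_eq] at hx hy ⊢
    have e : (((x * y : Gamma0 (2 * m)) : SL(2, ℤ)) 1 0 : ℤ) =
        (x : SL(2, ℤ)) 1 0 * (y : SL(2, ℤ)) 0 0 + (x : SL(2, ℤ)) 1 1 * (y : SL(2, ℤ)) 1 0 := by
      simp [Matrix.mul_apply, Fin.sum_univ_two]
    rw [e]
    exact dvd_add (Dvd.dvd.mul_right hx _) (Dvd.dvd.mul_left hy _)
  one_mem' := by simp
  inv_mem' := by
    intro x hx
    simp only [Set.mem_setOf_eq] at hx ⊢
    have e : (((x⁻¹ : Gamma0 (2 * m)) : SL(2, ℤ)) 1 0 : ℤ) = -((x : SL(2, ℤ)) 1 0) := by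
      simp [Matrix.SpecialLinearGroup.coe_inv, Matrix.adjugate_fin_two]
    rw [e]
    exact hx.neg_right

/-- Membership in `subB`. [folklore] -/
theorem mem_subB {γ : Gamma0 (2 * m)} : γ ∈ subB m ↔ ((2 * (2 * m) : ℕ) : ℤ) ∣ ((γ : SL(2, ℤ)) 1 0 : ℤ) :=
  Iff.rfl

variable {m}

/-- An element of `A` is `(a, 2b; c, d)`. [folklore] -/
theorem exists_eq_of_mem_subA {x : Gamma0 (2 * m)} (hx : x ∈ subA m) :
    ∃ (a b c d : ℤ) (h : a * d - (2 * b) * c = 1) (hc : ((2 * m : ℕ) : ℤ) ∣ c), x = g0Of a (2 * b) c d h hc := by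
  obtain ⟨b, hb⟩ := (mem_subA m).mp hx
  have hdet := gamma0_det_entries x
  rw [hb] at hdet
  refine ⟨_, b, _, _, hdet, ((ZMod.intCast_zmod_eq_zero_iff_dvd _ _).mp (Gamma0_mem.mp x.2)), ?_⟩
  calc x = g0Of ((x : SL(2, ℤ)) 0 0) ((x : SL(2, ℤ)) 0 1) ((x : SL(2, ℤ)) 1 0) ((x : SL(2, ℤ)) 1 1)
        (gamma0_det_entries x) ((ZMod.intCast_zmod_eq_zero_iff_dvd _ _).mp (Gamma0_mem.mp x.2)) :=
      (g0Of_entries x (gamma0_det_entries x) ((ZMod.intCast_zmod_eq_zero_iff_dvd _ _).mp (Gamma0_mem.mp x.2))).symm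
    _ = _ := g0Of_congr rfl hb rfl rfl _ _ _ _

/-- An element of `B` is `(a, b; c, d)` with `4m ∣ c`. [folklore] -/
theorem exists_eq_of_mem_subB {x : Gamma0 (2 * m)} (hx : x ∈ subB m) :
    ∃ (a b c d : ℤ) (h : a * d - b * c = 1) (hc : ((2 * m : ℕ) : ℤ) ∣ c),
      ((2 * (2 * m) : ℕ) : ℤ) ∣ c ∧ x = g0Of a b c d h hc :=
  ⟨_, _, _, _, gamma0_det_entries x, ((ZMod.intCast_zmod_eq_zero_iff_dvd _ _).mp (Gamma0_mem.mp x.2)), (mem_subB m).mp hx,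
    (g0Of_entries x (gamma0_det_entries x) ((ZMod.intCast_zmod_eq_zero_iff_dvd _ _).mp (Gamma0_mem.mp x.2))).symm⟩

/-- Every element is `g0Of` of some entries. [folklore] -/
theorem exists_eq_g0Of (x : Gamma0 (2 * m)) :
    ∃ (a b c d : ℤ) (h : a * d - b * c = 1) (hc : ((2 * m : ℕ) : ℤ) ∣ c), x = g0Of a b c d h hc :=
  ⟨_, _, _, _, gamma0_det_entries x, ((ZMod.intCast_zmod_eq_zero_iff_dvd _ _).mp (Gamma0_mem.mp x.2)),
    (g0Of_entries x (gamma0_det_entries x) ((ZMod.intCast_zmod_eq_zero_iff_dvd _ _).mp (Gamma0_mem.mp x.2))).symm⟩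

/-- `g0Of a (2b) c d ∈ A`. [folklore] -/
theorem g0Of_mem_subA (a b c d : ℤ) (h : a * d - (2 * b) * c = 1) (hc : ((2 * m : ℕ) : ℤ) ∣ c) :
    (g0Of a (2 * b) c d h hc : Gamma0 (2 * m)) ∈ subA m :=
  (mem_subA m).mpr ⟨b, rfl⟩

/-- `g0Of a b c d ∈ B` when `4m ∣ c`. [folklore] -/
theorem g0Of_mem_subB (a b c d : ℤ) (h : a * d - b * c = 1) (hc : ((2 * m : ℕ) : ℤ) ∣ c)
    (hc' : ((2 * (2 * m) : ℕ) : ℤ) ∣ c) : (g0Of a b c d h hc : Gamma0 (2 * m)) ∈ subB m :=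
  (mem_subB m).mpr hc'

/-- `T^k ∈ B`. [folklore] -/
theorem Tpow_mem_subB (k : ℤ) : (Tpow (2 * m) k) ∈ subB m := (mem_subB m).mpr (dvd_zero _)

/-- `(T^1)^k = T^k`. [folklore] -/
theorem Tpow_one_zpow (k : ℤ) : (Tpow (2 * m) 1) ^ k = Tpow (2 * m) k := by
  induction k using Int.induction_on with
  | zero => rw [zpow_zero, Tpow_zero]
  | succ n ih => rw [zpow_add_one, ih, Tpow_mul_Tpow]
  | pred n ih => rw [zpow_sub_one, ih, Tpow_inv, Tpow_mul_Tpow]; ring_nf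

end Concrete

/-! ### §2. The two maps `α = ε·φ∘coshift` on `A` and `φ' = φ` on `B`, and the descent engine -/

section Engine

variable {K : Type*} [CommRing K] {m : ℕ}

/-- `4m ∣ 2c` from `2m ∣ c`. [folklore] -/
theorem dvd_two_mul {c : ℤ} (hc : ((2 * m : ℕ) : ℤ) ∣ c) : ((2 * (2 * m) : ℕ) : ℤ) ∣ 2 * c := by
  obtain ⟨k, hk⟩ := hc
  exact ⟨k, by rw [hk]; push_cast; ring⟩

/-- **The coshift value** `φ(diag(2,1)⁻¹ γ diag(2,1)) = φ(a, b/2; 2c, d)` of `γ = (a b; c d) ∈ Γ₀(2m)` when `2 ∣ b`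
(junk `0` otherwise). [folklore] -/
noncomputable def coshiftVal (φ : Gamma0 (2 * (2 * m)) → K) (γ : Gamma0 (2 * m)) : K :=
  if h : (2 : ℤ) ∣ ((γ : SL(2, ℤ)) 0 1 : ℤ) then
    φ (g0Of ((γ : SL(2, ℤ)) 0 0) (((γ : SL(2, ℤ)) 0 1 : ℤ) / 2) (2 * (γ : SL(2, ℤ)) 1 0) ((γ : SL(2, ℤ)) 1 1)
      (by
        have hq : ((γ : SL(2, ℤ)) 0 1 : ℤ) / 2 * 2 = (γ : SL(2, ℤ)) 0 1 := Int.ediv_mul_cancel h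
        linear_combination gamma0_det_entries γ - ((γ : SL(2, ℤ)) 1 0 : ℤ) * hq)
      (dvd_two_mul ((ZMod.intCast_zmod_eq_zero_iff_dvd _ _).mp (Gamma0_mem.mp γ.2))))
  else 0

/-- `coshiftVal` on an explicit matrix `(a, 2b; c, d)`: `φ(a, b; 2c, d)`. [folklore] -/
theorem coshiftVal_g0Of (φ : Gamma0 (2 * (2 * m)) → K) (a b c d : ℤ) (h : a * d - (2 * b) * c = 1)
    (hc : ((2 * m : ℕ) : ℤ) ∣ c) (h' : a * d - b * (2 * c) = 1) (hc' : ((2 * (2 * m) : ℕ) : ℤ) ∣ 2 * c) :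
    coshiftVal φ (g0Of a (2 * b) c d h hc) = φ (g0Of a b (2 * c) d h' hc') := by
  unfold coshiftVal
  rw [dif_pos (show (2 : ℤ) ∣ (((g0Of a (2 * b) c d h hc : Gamma0 (2 * m)) : SL(2, ℤ)) 0 1 : ℤ) from ⟨b, rfl⟩)]
  congr 1
  exact g0Of_congr rfl (by show (2 * b) / 2 = b; exact Int.mul_ediv_cancel_left b (by norm_num)) rfl rfl _ _ _ _

/-- **The restriction value** `φ(γ)` for `γ ∈ Γ₀(2m)` with `4m ∣ c` (junk `0` otherwise). [folklore] -/
noncomputable def restrVal (φ : Gamma0 (2 * (2 * m)) → K) (γ : Gamma0 (2 * m)) : K :=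
  if h : ((2 * (2 * m) : ℕ) : ℤ) ∣ ((γ : SL(2, ℤ)) 1 0 : ℤ) then
    φ (g0Of ((γ : SL(2, ℤ)) 0 0) ((γ : SL(2, ℤ)) 0 1) ((γ : SL(2, ℤ)) 1 0) ((γ : SL(2, ℤ)) 1 1) (gamma0_det_entries γ) h)
  else 0

/-- `restrVal` on an explicit matrix with `4m ∣ c`. [folklore] -/
theorem restrVal_g0Of (φ : Gamma0 (2 * (2 * m)) → K) (a b c d : ℤ) (h : a * d - b * c = 1)
    (hc : ((2 * m : ℕ) : ℤ) ∣ c) (hc' : ((2 * (2 * m) : ℕ) : ℤ) ∣ c) :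
    restrVal φ (g0Of a b c d h hc) = φ (g0Of a b c d h hc') := by
  unfold restrVal
  rw [dif_pos (show ((2 * (2 * m) : ℕ) : ℤ) ∣ (((g0Of a b c d h hc : Gamma0 (2 * m)) : SL(2, ℤ)) 1 0 : ℤ) from hc')]
  rfl

variable (φ : Gamma0 (2 * (2 * m)) → K) (ε : K)

/-- `α := ε · coshiftVal φ` is additive on `A` (the coshift is multiplicative on `A`), for additive `φ`. [folklore] -/
theorem alpha_add (hadd : IsAdd φ) :
    ∀ x ∈ subA m, ∀ y ∈ subA m,
      ε * coshiftVal φ (x * y) = ε * coshiftVal φ x + ε * coshiftVal φ y := by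
  intro x hx y hy
  obtain ⟨a, b, c, d, h, hc, rfl⟩ := exists_eq_of_mem_subA hx
  obtain ⟨a', b', c', d', h', hc', rfl⟩ := exists_eq_of_mem_subA hy
  rw [← mul_add]
  congr 1
  have hcp : ((2 * m : ℕ) : ℤ) ∣ c * a' + d * c' := dvd_add (Dvd.dvd.mul_right hc _) (Dvd.dvd.mul_left hc' _)
  have hprod : (g0Of a (2 * b) c d h hc * g0Of a' (2 * b') c' d' h' hc' : Gamma0 (2 * m)) =
      g0Of (a * a' + (2 * b) * c') (2 * (a * b' + b * d')) (c * a' + d * c') (c * (2 * b') + d * d')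
        (by linear_combination (det_mul_entries h h')) hcp := by
    rw [g0Of_mul a (2 * b) c d a' (2 * b') c' d' h hc h' hc' (det_mul_entries h h') hcp]
    exact g0Of_congr rfl (by ring) rfl rfl _ _ _ _
  have hcp' : ((2 * (2 * m) : ℕ) : ℤ) ∣ 2 * c * a' + d * (2 * c') := by
    have := dvd_two_mul hcp
    have e : 2 * (c * a' + d * c') = 2 * c * a' + d * (2 * c') := by ring
    rwa [e] at this
  rw [hprod, coshiftVal_g0Of φ _ _ _ _ _ _ (by linear_combination (det_mul_entries h h')) (dvd_two_mul hcp),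
    coshiftVal_g0Of φ a b c d h hc (by linear_combination h) (dvd_two_mul hc),
    coshiftVal_g0Of φ a' b' c' d' h' hc' (by linear_combination h') (dvd_two_mul hc'), ← hadd,
    g0Of_mul a b (2 * c) d a' b' (2 * c') d' _ _ _ _ (det_mul_entries (by linear_combination h)
      (by linear_combination h')) hcp']
  congr 1
  exact g0Of_congr (by ring) (by ring) (by ring) (by ring) _ _ _ _

/-- `φ' := restrVal φ` is additive on `B`, for additive `φ`. [folklore] -/
theorem restr_add (hadd : IsAdd φ) :
    ∀ x ∈ subB m, ∀ y ∈ subB m, restrVal φ (x * y) = restrVal φ x + restrVal φ y := by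
  intro x hx y hy
  obtain ⟨a, b, c, d, h, hc, hc4, rfl⟩ := exists_eq_of_mem_subB hx
  obtain ⟨a', b', c', d', h', hc', hc4', rfl⟩ := exists_eq_of_mem_subB hy
  have hc4'' : ((2 * (2 * m) : ℕ) : ℤ) ∣ c * a' + d * c' := dvd_add (Dvd.dvd.mul_right hc4 _) (Dvd.dvd.mul_left hc4' _)
  rw [g0Of_mul a b c d a' b' c' d' h hc h' hc' (det_mul_entries h h')
      (dvd_add (Dvd.dvd.mul_right hc _) (Dvd.dvd.mul_left hc' _)),
    restrVal_g0Of φ _ _ _ _ _ _ hc4'', restrVal_g0Of φ a b c d h hc hc4, restrVal_g0Of φ a' b' c' d' h' hc' hc4', ← hadd,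
    g0Of_mul]

/-- **Agreement on `C = A ∩ B`**: `ε·φ(coshift γ) = φ(γ)` for `γ = (a, 2b; c, d)` with `4m ∣ c`, from the `ε`-eigen relation
of `φ` under the 2-shift on `Γ₀(8m)`. [folklore] -/
theorem alpha_eq_restr (hinv : IsShiftEigen ε φ) :
    ∀ x ∈ subA m, x ∈ subB m → ε * coshiftVal φ x = restrVal φ x := by
  intro x hx hxB
  obtain ⟨a, b, c, d, h, hc, rfl⟩ := exists_eq_of_mem_subA hx
  have hc4 : ((2 * (2 * m) : ℕ) : ℤ) ∣ c := (mem_subB m).mp hxB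
  rw [coshiftVal_g0Of φ a b c d h hc (by linear_combination h) (dvd_two_mul hc),
    restrVal_g0Of φ a (2 * b) c d h hc hc4, hinv a b c d (by linear_combination h) hc4]

/-- The exponent map `n(γ) := a·b`: `γ · T^{−ab} ∈ A` (`b − a²b = b(1 − a²)`, `2 ∣ 1 − a²`). [folklore] -/
theorem mul_Tpow_neg_mem_subA (x : Gamma0 (2 * m)) :
    x * (Tpow (2 * m) 1) ^ (-(((x : SL(2, ℤ)) 0 0 : ℤ) * (x : SL(2, ℤ)) 0 1)) ∈ subA m := by
  obtain ⟨a, b, c, d, h, hc, rfl⟩ := exists_eq_g0Of x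
  obtain ⟨-, haa, -⟩ := two_dvd_of_det (M := 2 * m) ⟨m, rfl⟩ h hc
  rw [Tpow_one_zpow, g0Of_mul_Tpow a b c d h hc _ (by linear_combination h), mem_subA]
  show (2 : ℤ) ∣ a * -(a * b) + b
  have : a * -(a * b) + b = -(b * (a * a - 1)) := by ring
  rw [this]
  exact (Dvd.dvd.mul_left haa b).neg_right

/-- For `γ ∈ A`, `T^{n(γ)} ∈ A` (`2 ∣ b_γ`). [folklore] -/
theorem Tpow_n_mem_subA (x : Gamma0 (2 * m)) (hx : x ∈ subA m) :
    (Tpow (2 * m) 1) ^ (((x : SL(2, ℤ)) 0 0 : ℤ) * (x : SL(2, ℤ)) 0 1) ∈ subA m := by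
  rw [Tpow_one_zpow, Tpow, mem_subA]
  exact Dvd.dvd.mul_left ((mem_subA m).mp hx) _

/-- The element `Q₁ = (1 − 2m, 2m; −2m, 1 + 2m) ∈ A` (the parabolic of `Γ₀(2m)` at the cusp `1`). [folklore] -/
def Q1 (m : ℕ) : Gamma0 (2 * m) :=
  g0Of (1 - 2 * m) (2 * m) (-(2 * m)) (1 + 2 * m) (by ring) ⟨-1, by push_cast; ring⟩

/-- `Q₁ ∈ A`. [folklore] -/
theorem Q1_mem_subA : Q1 m ∈ subA m := (mem_subA m).mpr ⟨m, by simp [Q1, g0Of, slOf]⟩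

/-- **`Q₁` generates `A` modulo `A ∩ B`** (index `2`): for `γ ∈ A` one of `γ`, `γ Q₁` lies in `B` (DICHOTOMY). [folklore] -/
theorem exists_mul_Q1_zpow_mem_subB (x : Gamma0 (2 * m)) (hx : x ∈ subA m) :
    ∃ e : ℤ, x * (Q1 m) ^ (-e) ∈ subB m := by
  obtain ⟨a, b, c, d, h, hc, rfl⟩ := exists_eq_of_mem_subA hx
  obtain ⟨c₀, hc₀⟩ := hc
  rcases dichotomy (M := 2 * m) ⟨m, rfl⟩ h hc₀ with h0 | h0
  · refine ⟨0, ?_⟩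
    rw [neg_zero, zpow_zero, mul_one, mem_subB]
    show ((2 * (2 * m) : ℕ) : ℤ) ∣ c
    obtain ⟨k, hk⟩ := h0
    exact ⟨k, by rw [hc₀, hk]; push_cast; ring⟩
  · -- `γ Q₁` has lower-left entry `c − 2m(c + d) = 2m(c₀ − c − d)`
    refine ⟨-1, ?_⟩
    rw [neg_neg, zpow_one, Q1, g0Of_mul a (2 * b) c d _ _ _ _ _ _ _ _ (by linear_combination h)
      (dvd_add (Dvd.dvd.mul_right ⟨c₀, hc₀⟩ _) (Dvd.dvd.mul_left ⟨-1, by push_cast; ring⟩ _)), mem_subB]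
    show ((2 * (2 * m) : ℕ) : ℤ) ∣ c * (1 - 2 * m) + d * -(2 * m)
    obtain ⟨k, hk⟩ := h0
    exact ⟨k, by rw [show c * (1 - 2 * (m : ℤ)) + d * -(2 * m) = c - 2 * m * (c + d) by ring,
      show (c : ℤ) - 2 * m * (c + d) = 2 * m * (c₀ - c - d) by rw [hc₀]; push_cast; ring, hk]; push_cast; ring⟩

/-- The parabolic `P_{1/2} = (1 − 2m, m; −4m, 1 + 2m) ∈ Γ₀(4m)` at the cusp `1/2` (`= diag(2,1)⁻¹ Q₁ diag(2,1)`), the generator of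
the stabiliser of `1/2` in `Γ₀(4m)`. [folklore] -/
def Phalf (m : ℕ) : Gamma0 (2 * (2 * m)) :=
  g0Of (1 - 2 * m) m (-(4 * m)) (1 + 2 * m) (by ring) ⟨-1, by push_cast; ring⟩

/-- The parabolic `P₁ = (1 − 4m, 4m; −4m, 1 + 4m) ∈ Γ₀(4m)` at the cusp `1` (`= diag(2,1)⁻¹ T Q₁ T⁻¹ diag(2,1)`). [folklore] -/
def Pone (m : ℕ) : Gamma0 (2 * (2 * m)) :=
  g0Of (1 - 4 * m) (4 * m) (-(4 * m)) (1 + 4 * m) (by ring) ⟨-1, by push_cast; ring⟩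

/-- `coshiftVal φ Q₁ = φ(P_{1/2})`. [folklore] -/
theorem coshiftVal_Q1 : coshiftVal φ (Q1 m) = φ (Phalf m) := by
  rw [Q1, coshiftVal_g0Of φ (1 - 2 * m) m (-(2 * m)) (1 + 2 * m) (by ring) _ (by ring) ⟨-1, by push_cast; ring⟩, Phalf]
  congr 1
  exact g0Of_congr rfl rfl (by ring) rfl _ _ _ _

/-- `coshiftVal φ (T Q₁ T⁻¹) = φ(P₁)`. [folklore] -/
theorem coshiftVal_conj_Q1 :
    coshiftVal φ (Tpow (2 * m) 1 * Q1 m * (Tpow (2 * m) 1)⁻¹) = φ (Pone m) := by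
  rw [Tpow_inv, Q1, Tpow_one_mul_mul_Tpow_neg_one _ _ _ _ _ _ (by ring)]
  have e : g0Of (M := 2 * m) (1 - 2 * (m : ℤ) + -(2 * m)) (2 * m + (1 + 2 * m) - (1 - 2 * m) - -(2 * m)) (-(2 * m))
        (1 + 2 * m - -(2 * m)) (by ring) ⟨-1, by push_cast; ring⟩ =
      g0Of (1 - 4 * m) (2 * (4 * m)) (-(2 * m)) (1 + 4 * m) (by ring) ⟨-1, by push_cast; ring⟩ :=
    g0Of_congr (by ring) (by ring) rfl (by ring) _ _ _ _
  rw [e, coshiftVal_g0Of φ (1 - 4 * m) (4 * m) (-(2 * m)) (1 + 4 * m) (by ring) _ (by ring) ⟨-1, by push_cast; ring⟩,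
    Pone]
  congr 1
  exact g0Of_congr rfl rfl (by ring) rfl _ _ _ _

/-- **THE DESCENT ENGINE at `p = 2`.**  Let `φ : Γ₀(4m) → K` be additive and an `ε`-eigenfunction of the 2-shift
(`φ(a, 2b; c, d) = ε·φ(a, b; 2c, d)` for `4m ∣ c`), and suppose `φ(P₁) = φ(P_{1/2})`.  Then `φ` is the restriction of an additive
`ε`-eigenfunction `w : Γ₀(2m) → K`.  Proof: glue `α = ε·φ∘coshift` on `A = {2 ∣ b}` with `φ` on `B = Γ₀(4m)` (`glue`); the
conjugation invariance of `α` under `T` is `conj_invariant_of_generator` with `q = Q₁`, whose hypothesis `α(TQ₁T⁻¹) = α(Q₁)` is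
exactly `φ(P₁) = φ(P_{1/2})`. [folklore] -/
theorem descent (hadd : IsAdd φ) (hinv : IsShiftEigen ε φ) (hP : φ (Pone m) = φ (Phalf m)) :
    ∃ w : Gamma0 (2 * m) → K, IsAdd w ∧ IsShiftEigen ε w ∧ RestrictsFrom φ w := by
  have hAn := subA_normal m
  have hα := alpha_add (m := m) φ ε hadd
  have hφ' := restr_add (m := m) φ hadd
  have hC := alpha_eq_restr (m := m) φ ε hinv
  have ht : Tpow (2 * m) 1 ∈ subB m := Tpow_mem_subB 1
  have hκ : ε * coshiftVal φ (Tpow (2 * m) 1 * Q1 m * (Tpow (2 * m) 1)⁻¹) = ε * coshiftVal φ (Q1 m) := by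
    rw [coshiftVal_conj_Q1, coshiftVal_Q1, hP]
  have hinvT := conj_invariant_of_generator hAn hα hφ' hC ht Q1_mem_subA exists_mul_Q1_zpow_mem_subB hκ
  obtain ⟨hW, hWA, hWB⟩ := glue hAn hα hφ' hC ht hinvT
    (fun g => ((g : SL(2, ℤ)) 0 0 : ℤ) * (g : SL(2, ℤ)) 0 1) mul_Tpow_neg_mem_subA Tpow_n_mem_subA
  refine ⟨fun g => ε * coshiftVal φ (g * Tpow (2 * m) 1 ^ (-(((g : SL(2, ℤ)) 0 0 : ℤ) * (g : SL(2, ℤ)) 0 1))) +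
      (((g : SL(2, ℤ)) 0 0 : ℤ) * (g : SL(2, ℤ)) 0 1) • restrVal φ (Tpow (2 * m) 1), ?_, ?_, ?_⟩
  · intro g h
    exact hW g h
  · intro a b c d h hc
    simp only
    rw [hWA _ (g0Of_mem_subA a b c d (by linear_combination h) hc),
      hWB _ (g0Of_mem_subB a b (2 * c) d h _ (dvd_two_mul hc)),
      coshiftVal_g0Of φ a b c d (by linear_combination h) hc h (dvd_two_mul hc),
      restrVal_g0Of φ a b (2 * c) d h _ (dvd_two_mul hc)]
  · intro a b c d h hcN hcM
    show φ _ = _ + _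
    rw [hWB _ (g0Of_mem_subB a b c d h hcM hcN), restrVal_g0Of φ a b c d h hcM hcN]

end Engine

end TwoShift

end Summit.BirchSwinnertonDyer.BirchSwinnertonDyer.Theorems.ManinLocalTwoThree
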